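import Literature.NumberTheory.Transcendental.KZLogCalculusProofs
import Literature.NumberTheory.Transcendental.BoxIntegralZetaValues
import Literature.NumberTheory.Transcendental.KZIntervalPeriodProofs

/-!
# `NormalFormPrinciple` (stmt-KontsevichZagierPeriods-3869), line `SketchIdeator1` —
# the leaf `stub_boxRigidity` in dimension two, level one: the triangle representations exist

Pure proof file (stub `exists_triangleRep` of the dimension-two layer, lead seat c7; `--supports` the
crux). The merge gadget `(x₀, x₁) ↦ (x₀, x₀x₁)` (rule (2)) sends an off-diagonal monomial
`c·x₀^a x₁^b/(1 − x₀x₁)` (`a > b`) of the level-one family `[(0,1)², P/(1 − x₀x₁)]` onto the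
closed-fibre TRIANGLE `T = {0 < z₀ < 1, 0 ≤ z₁ ≤ z₀}` (a band over the open unit interval of `ℝ¹`,
`KZlog.band`) with the integrand `g(z) = c·z₀^{a−b−1} z₁^b/(1 − z₁)`. We show that `[T, g]` is an
integral representation of the tree's Kontsevich–Zagier calculus (`KZ.IntegralRep 2`):

* `T` is `ℚ`-semialgebraic (`KZlog.isSemialgebraic_band`);
* `g` is a quotient of `ℚ`-polynomials whose denominator `1 − z₁ ≥ 1 − z₀ > 0` does not vanish on `T`
  (`isSemialgebraicFunOn_aeval_div_aeval`);
* absolute convergence (the content): by the change of variables `z = (x₀, x₀x₁)` (Jacobian `x₀`,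
  injective on `x₀ > 0`; `MeasureTheory.integrableOn_image_iff_integrableOn_abs_det_fderiv_smul`)
  from the box `B₀ = {0 < x₀ < 1, 0 ≤ x₁ ≤ 1}`, whose image is `T`, integrability of `g` on `T`
  amounts to that of `x₀ · g(x₀, x₀x₁) = c·x₀^{a−b} (x₀x₁)^b/(1 − x₀x₁)` on `B₀`; this is dominated by
  `|c|/(1 − x₀x₁)`, integrable on the open box (Beukers' integral for `ζ(2)`,
  `box_integral_one_div_one_sub_mul_two`), and `B₀` exceeds the open box by two null edges.
  (The cruder bound `|g| ≤ |c|/(1 − z₀)` is NOT integrable on `T`.)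

Sources: M. Kontsevich, D. Zagier, *Periods* (2001), §1.1–1.2; F. Beukers, *A note on the
irrationality of ζ(2) and ζ(3)*, Bull. LMS 11 (1979). No definitions are introduced.
-/

noncomputable section

open MeasureTheory Set
open Literature.NumberTheory.Transcendental Literature.NumberTheory.Transcendental.KZ
open Literature.ModelTheory.ExponentialFields (IsSemialgebraic)

namespace Summit.KontsevichZagierPeriods.HurwitzMicroSectors.NormalFormPrinciple.PiBox.LevelOne

/-! ## The triangle and the merge chart -/

/-- The triangle `T = {0 < z₀ < 1, 0 ≤ z₁ ≤ z₀}` (membership in the band is definitionally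
`(0 < z 0 ∧ z 0 < 1) ∧ 0 ≤ z 1 ∧ z 1 ≤ z 0`, cf. `SectorToKernel.z2_mem_tri`) is `ℚ`-semialgebraic:
a band with semialgebraic base and edges. [Kontsevich–Zagier 2001, §1.1] [folklore] -/
theorem isSemialgebraic_triangleBand :
    IsSemialgebraic ℚ
      (KZlog.band {y : Fin 1 → ℝ | 0 < y 0 ∧ y 0 < 1} (fun _ => (0:ℝ)) (fun y => y 0)) := by
  have hG : IsSemialgebraic ℚ {y : Fin 1 → ℝ | 0 < y 0 ∧ y 0 < 1} :=
    isSemialgebraic_unitInterval_fin_one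
  exact KZlog.isSemialgebraic_band (by simpa using isSemialgebraicFunOn_ratCast hG 0)
    (isSemialgebraicFunOn_apply hG 0)

/-- **Semialgebraicity of the triangle integrand.** `z ↦ c·z₀^{a−b−1} z₁^b/(1 − z₁)` is a
`ℚ`-semialgebraic function on `T` (a quotient of `ℚ`-polynomials, denominator `1 − z₁ ≥ 1 − z₀ > 0`).
[Kontsevich–Zagier 2001, §1.1] [folklore] -/
theorem isSemialgebraicFunOn_triangleIntegrand (a b : ℕ) (c : ℚ) :
    IsSemialgebraicFunOn ℚ
      (KZlog.band {y : Fin 1 → ℝ | 0 < y 0 ∧ y 0 < 1} (fun _ => (0:ℝ)) (fun y => y 0))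
      (fun z => (c : ℝ) * (z 0 ^ (a - b - 1) * z 1 ^ b) / (1 - z 1)) := by
  refine (isSemialgebraicFunOn_aeval_div_aeval isSemialgebraic_triangleBand
    (MvPolynomial.C c * (MvPolynomial.X 0 ^ (a - b - 1) * MvPolynomial.X 1 ^ b))
    (1 - MvPolynomial.X 1) fun z hz => ?_).congr fun z _ => by simp
  have h : (0 < z 0 ∧ z 0 < 1) ∧ 0 ≤ z 1 ∧ z 1 ≤ z 0 := hz
  simp only [map_sub, map_one, MvPolynomial.aeval_X]
  exact (show (0:ℝ) < 1 - z 1 by linarith [h.1.2, h.2.2]).ne'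

/-- The derivative of the merge chart `(x₀, x₁) ↦ (x₀, x₀x₁)` (Jacobian matrix `!![1, 0; x₁, x₀]`).
[folklore] -/
theorem hasFDerivAt_mergeChart (x : Fin 2 → ℝ) :
    HasFDerivAt (fun y : Fin 2 → ℝ => (![y 0, y 0 * y 1] : Fin 2 → ℝ))
      (LinearMap.toContinuousLinearMap (Matrix.toLin' !![(1:ℝ), 0; x 1, x 0])) x := by
  have p0 : HasFDerivAt (fun y : Fin 2 → ℝ => y 0)
      (ContinuousLinearMap.proj (R := ℝ) (φ := fun _ : Fin 2 => ℝ) 0) x := hasFDerivAt_apply 0 x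
  have p1 : HasFDerivAt (fun y : Fin 2 → ℝ => y 1)
      (ContinuousLinearMap.proj (R := ℝ) (φ := fun _ : Fin 2 => ℝ) 1) x := hasFDerivAt_apply 1 x
  have c0 : HasFDerivAt (fun y : Fin 2 → ℝ => (![y 0, y 0 * y 1] : Fin 2 → ℝ) 0)
      ((ContinuousLinearMap.proj 0).comp
        (LinearMap.toContinuousLinearMap (Matrix.toLin' !![(1:ℝ), 0; x 1, x 0]))) x := by
    refine p0.congr_fderiv ?_
    ext v
    simp [dotProduct, Fin.sum_univ_two]
  have c1 : HasFDerivAt (fun y : Fin 2 → ℝ => (![y 0, y 0 * y 1] : Fin 2 → ℝ) 1)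
      ((ContinuousLinearMap.proj 1).comp
        (LinearMap.toContinuousLinearMap (Matrix.toLin' !![(1:ℝ), 0; x 1, x 0]))) x := by
    refine (p0.mul p1).congr_fderiv ?_
    ext v
    simp [dotProduct, Fin.sum_univ_two]
    ring
  rw [hasFDerivAt_pi']
  intro i
  fin_cases i
  · exact c0
  · exact c1

/-- The Jacobian determinant of the merge chart is `x₀`. [folklore] -/
theorem det_mergeChartDeriv (x : Fin 2 → ℝ) :
    (LinearMap.toContinuousLinearMap (Matrix.toLin' !![(1:ℝ), 0; x 1, x 0])).det = x 0 := by
  have h : (!![(1:ℝ), 0; x 1, x 0] : Matrix (Fin 2) (Fin 2) ℝ).det = x 0 := by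
    simp [Matrix.det_fin_two]
  exact (LinearMap.det_toLin' _).trans h

/-! ## Absolute convergence on the triangle -/

/-- **The kernel `1/(1 − x₀x₁)` is integrable on the band-box** `B₀ = {0 < x₀ < 1, 0 ≤ x₁ ≤ 1}`:
Beukers' integral on the open box (`box_integral_one_div_one_sub_mul_two`) plus two null edges.
[folklore] -/
theorem integrableOn_kernel_bandBox :
    IntegrableOn (fun x : Fin 2 → ℝ => 1 / (1 - x 0 * x 1))
      {x : Fin 2 → ℝ | (0 < x 0 ∧ x 0 < 1) ∧ 0 ≤ x 1 ∧ x 1 ≤ 1} := by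
  have hsub : {x : Fin 2 → ℝ | (0 < x 0 ∧ x 0 < 1) ∧ 0 ≤ x 1 ∧ x 1 ≤ 1} ⊆
      {x : Fin 2 → ℝ | ∀ i, x i ∈ Set.Ioo (0:ℝ) 1} ∪ ({x | x 1 = 0} ∪ {x | x 1 = 1}) := by
    intro x hx
    rcases eq_or_ne (x 1) 0 with h0 | h0
    · exact Or.inr (Or.inl h0)
    rcases eq_or_ne (x 1) 1 with h1 | h1
    · exact Or.inr (Or.inr h1)
    exact Or.inl (Fin.forall_fin_two.2
      ⟨hx.1, lt_of_le_of_ne hx.2.1 h0.symm, lt_of_le_of_ne hx.2.2 h1⟩)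
  have hnull : volume ({x : Fin 2 → ℝ | x 1 = 0} ∪ {x | x 1 = 1}) = 0 :=
    measure_union_null (Measure.pi_hyperplane (fun _ => (volume : Measure ℝ)) 1 0)
      (Measure.pi_hyperplane (fun _ => (volume : Measure ℝ)) 1 1)
  exact (box_integral_one_div_one_sub_mul_two.1.union (IntegrableOn.of_measure_zero hnull)).mono_set
    hsub

/-- **Absolute convergence of the triangle integrand.** `c·z₀^{a−b−1} z₁^b/(1 − z₁)` is integrable
on `T`: change of variables `z = (x₀, x₀x₁)` from the band-box `B₀` (Jacobian `x₀`), where the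
pulled-back integrand `c·x₀^{a−b}(x₀x₁)^b/(1 − x₀x₁)` is dominated by `|c|/(1 − x₀x₁)`.
[Kontsevich–Zagier 2001, §1.2 rule (2)] [folklore] -/
theorem integrableOn_triangleIntegrand (a b : ℕ) (c : ℚ) :
    IntegrableOn (fun z : Fin 2 → ℝ => (c : ℝ) * (z 0 ^ (a - b - 1) * z 1 ^ b) / (1 - z 1))
      (KZlog.band {y : Fin 1 → ℝ | 0 < y 0 ∧ y 0 < 1} (fun _ => (0:ℝ)) (fun y => y 0)) := by
  set S : Set (Fin 2 → ℝ) := {x | (0 < x 0 ∧ x 0 < 1) ∧ 0 ≤ x 1 ∧ x 1 ≤ 1}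
  have hSm : MeasurableSet S := by
    have h0 : Measurable fun x : Fin 2 → ℝ => x 0 := measurable_pi_apply 0
    have h1 : Measurable fun x : Fin 2 → ℝ => x 1 := measurable_pi_apply 1
    exact ((measurableSet_lt measurable_const h0).inter (measurableSet_lt h0 measurable_const)).inter
      ((measurableSet_le measurable_const h1).inter (measurableSet_le h1 measurable_const))
  -- the change of variables
  have hder : ∀ x ∈ S, HasFDerivWithinAt (fun y : Fin 2 → ℝ => (![y 0, y 0 * y 1] : Fin 2 → ℝ))
      (LinearMap.toContinuousLinearMap (Matrix.toLin' !![(1:ℝ), 0; x 1, x 0])) S x :=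
    fun x _ => (hasFDerivAt_mergeChart x).hasFDerivWithinAt
  have hinj : InjOn (fun y : Fin 2 → ℝ => (![y 0, y 0 * y 1] : Fin 2 → ℝ)) S := by
    intro x hx y hy h
    have e0 : x 0 = y 0 := by simpa using congrFun h 0
    have e1 : x 0 * x 1 = y 0 * y 1 := by simpa using congrFun h 1
    rw [e0] at e1
    have e1' : x 1 = y 1 := mul_left_cancel₀ hy.1.1.ne' e1
    funext i
    fin_cases i
    · exact e0
    · exact e1'
  have key := integrableOn_image_iff_integrableOn_abs_det_fderiv_smul volume hSm hder hinj
    (fun z : Fin 2 → ℝ => (c : ℝ) * (z 0 ^ (a - b - 1) * z 1 ^ b) / (1 - z 1))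
  -- the triangle is the image of the band-box
  have hTsub : KZlog.band {y : Fin 1 → ℝ | 0 < y 0 ∧ y 0 < 1} (fun _ => (0:ℝ)) (fun y => y 0) ⊆
      (fun y : Fin 2 → ℝ => (![y 0, y 0 * y 1] : Fin 2 → ℝ)) '' S := by
    intro z hz
    have h : (0 < z 0 ∧ z 0 < 1) ∧ 0 ≤ z 1 ∧ z 1 ≤ z 0 := hz
    refine ⟨![z 0, z 1 / z 0], ?_, ?_⟩
    · show (0 < _ ∧ _ < 1) ∧ 0 ≤ _ ∧ _ ≤ 1
      simp only [Matrix.cons_val_zero, Matrix.cons_val_one]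
      exact ⟨h.1, div_nonneg h.2.1 h.1.1.le, (div_le_one h.1.1).2 h.2.2⟩
    · funext i
      fin_cases i
      · simp
      · simp [mul_div_cancel₀ _ h.1.1.ne']
  -- the pulled-back integrand is dominated by `|c|/(1 − x₀x₁)`
  have hF : IntegrableOn (fun x : Fin 2 → ℝ =>
      x 0 * ((c : ℝ) * (x 0 ^ (a - b - 1) * (x 0 * x 1) ^ b) / (1 - x 0 * x 1))) S := by
    refine Integrable.mono' (integrableOn_kernel_bandBox.const_mul |(c:ℝ)|) ?_
      (ae_restrict_of_forall_mem hSm fun x hx => ?_)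
    · exact (Measurable.aestronglyMeasurable (by fun_prop))
    · have hx0 : 0 < x 0 := hx.1.1
      have hx0' : x 0 ≤ 1 := hx.1.2.le
      have hp0 : 0 ≤ x 0 * x 1 := mul_nonneg hx0.le hx.2.1
      have hp1 : x 0 * x 1 < 1 := (mul_le_of_le_one_right hx0.le hx.2.2).trans_lt hx.1.2
      have hD : 0 < 1 - x 0 * x 1 := sub_pos.2 hp1
      have hPnn : 0 ≤ x 0 ^ (a - b - 1) * (x 0 * x 1) ^ b := by positivity
      have hP : x 0 * (x 0 ^ (a - b - 1) * (x 0 * x 1) ^ b) ≤ 1 :=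
        mul_le_one₀ hx0' hPnn (mul_le_one₀ (pow_le_one₀ hx0.le hx0') (by positivity)
          (pow_le_one₀ hp0 hp1.le))
      calc ‖x 0 * ((c : ℝ) * (x 0 ^ (a - b - 1) * (x 0 * x 1) ^ b) / (1 - x 0 * x 1))‖
          = x 0 * (x 0 ^ (a - b - 1) * (x 0 * x 1) ^ b) * (|(c:ℝ)| / (1 - x 0 * x 1)) := by
            rw [Real.norm_eq_abs, abs_mul, abs_div, abs_mul, abs_of_pos hx0, abs_of_pos hD,
              abs_of_nonneg hPnn]
            ring
        _ ≤ |(c:ℝ)| / (1 - x 0 * x 1) :=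
            mul_le_of_le_one_left (div_nonneg (abs_nonneg _) hD.le) hP
        _ = |(c:ℝ)| * (1 / (1 - x 0 * x 1)) := by ring
  refine (key.2 (hF.congr_fun (fun x hx => ?_) hSm)).mono_set hTsub
  have hx0 : 0 < x 0 := hx.1.1
  rw [det_mergeChartDeriv, abs_of_pos hx0, smul_eq_mul]
  simp only [Matrix.cons_val_zero, Matrix.cons_val_one]

/-- **E2 (existence of the triangle representation).** For `a > b` and `c ∈ ℚ` there is an
integral representation of dimension `2` with domain the closed-fibre triangle
`T = {0 < z₀ < 1, 0 ≤ z₁ ≤ z₀}` and integrand `z ↦ c·z₀^{a−b−1} z₁^b/(1 − z₁)` — the image of the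
box monomial `c·x₀^a x₁^b/(1 − x₀x₁)` under the merge gadget `(x₀, x₁) ↦ (x₀, x₀x₁)`.
[Kontsevich–Zagier 2001, §1.1–1.2] [folklore] -/
theorem exists_triangleRep (a b : ℕ) (c : ℚ) (hab : b < a) :
    ∃ R : IntegralRep 2,
      R.domain = KZlog.band {y : Fin 1 → ℝ | 0 < y 0 ∧ y 0 < 1} (fun _ => (0:ℝ)) (fun y => y 0) ∧
      R.integrand = fun z => (c : ℝ) * (z 0 ^ (a - b - 1) * z 1 ^ b) / (1 - z 1) := by
  have _ := hab -- existence does not need `b < a` (for `b ≥ a` the exponent `a - b - 1` is `0`)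
  exact ⟨⟨_, _, isSemialgebraic_triangleBand, isSemialgebraicFunOn_triangleIntegrand a b c,
    integrableOn_triangleIntegrand a b c⟩, rfl, rfl⟩

end Summit.KontsevichZagierPeriods.HurwitzMicroSectors.NormalFormPrinciple.PiBox.LevelOne
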